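import Literature.Analysis.Asymptotics.ComplexLinearRecurrenceDominantRoot
import HarnessLib

/-!
# Growth bound for an order-three linear recurrence from a bound on ALL characteristic roots

Topic `Literature/Analysis/Asymptotics` (continues `ComplexLinearRecurrenceDominantRoot.lean`: `norm_le_of_rec_two_complex` — an order-two complex
recurrence whose characteristic roots have modulus `≤ R` grows at most like `(n+1)Rⁿ` — and `exists_tendsto_norm_sub_le_of_rec_three_complex` — the
DOMINANT-root case of order three).  THIS FILE is the complementary "no dominant root" case of order three: if EVERY root of `τ³ − Aτ² − Bτ − C` has
modulus `≤ R` (`R > 0`), then every solution of `b(n+3) = A b(n+2) + B b(n+1) + C b(n)` satisfies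
`‖b(n)‖ ≤ (n+1)²Rⁿ·(2‖b₀‖ + 2‖b₁‖/R + ‖b₂‖/R²)` — uniformly in the coefficients (the constant only involves `R` and the initial data), which is what
a uniform exponential bound along a compact family of recurrences needs (e.g. a partition function at fugacity `ye^{iu}`, `u` away from `2πℤ`).

* `exists_cubic_root` — a complex cubic `τ³ − Aτ² − Bτ − C` has a root (fundamental theorem of algebra).
* ★★ `norm_le_of_rec_three_all_roots` — the bound above (factor one root `τ₁` out: `g(n) = b(n+1) − τ₁b(n)` obeys the cofactor order-two recurrence,
  `norm_le_of_rec_two_complex`, then a discrete Duhamel sum).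

## Sources
R. P. Stanley, *Enumerative Combinatorics* I (2nd ed.) §4.1 Theorem 4.1.1 (iii) (coefficients of rational functions: exponential polynomials, growth governed
by the pole moduli); lane statement with explicit constants, nothing quoted AS PRINTED.
-/

noncomputable section

open Polynomial

namespace Literature.Analysis.Asymptotics

/-- A complex cubic `τ³ − Aτ² − Bτ − C` has a root. [cite: Stanley2012EC1, §4.1 (lane plumbing: fundamental theorem of algebra)] -/
theorem exists_cubic_root (A B C : ℂ) : ∃ τ : ℂ, τ ^ 3 - A * τ ^ 2 - B * τ - C = 0 := by
  set p : Polynomial ℂ := X ^ 3 - Polynomial.C A * X ^ 2 - Polynomial.C B * X - Polynomial.C C with hp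
  have hdeg : p.degree = 3 := by
    rw [hp]
    have e : (X ^ 3 - Polynomial.C A * X ^ 2 - Polynomial.C B * X - Polynomial.C C : Polynomial ℂ)
        = Polynomial.C 1 * X ^ 3 + Polynomial.C (-A) * X ^ 2 + Polynomial.C (-B) * X + Polynomial.C (-C) := by
      simp only [map_one, one_mul, map_neg, neg_mul]
      ring
    rw [e]
    exact Polynomial.degree_cubic one_ne_zero
  obtain ⟨τ, hτ⟩ := Complex.exists_root (by rw [hdeg]; norm_num)
  refine ⟨τ, ?_⟩
  have h := hτ
  rw [Polynomial.IsRoot, hp] at h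
  simpa using h

/-- ★★ **GROWTH BOUND FROM A BOUND ON ALL ROOTS (order three).**  If every root of `τ³ − Aτ² − Bτ − C` has modulus `≤ R`, `0 < R`, and
`b(n+3) = A b(n+2) + B b(n+1) + C b(n)` for all `n`, then for every `n`:
`‖b(n)‖ ≤ (n+1)²·Rⁿ·(2‖b₀‖ + 2‖b₁‖/R + ‖b₂‖/R²)`.
[cite: Stanley2012EC1, §4.1 Theorem 4.1.1 (iii) (lane statement, explicit constants)] -/
theorem norm_le_of_rec_three_all_roots {A B C : ℂ} {R : ℝ} (hR : 0 < R)
    (hroot : ∀ τ : ℂ, τ ^ 3 - A * τ ^ 2 - B * τ - C = 0 → ‖τ‖ ≤ R)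
    (b : ℕ → ℂ) (hb : ∀ n, b (n + 3) = A * b (n + 2) + B * b (n + 1) + C * b n) (n : ℕ) :
    ‖b n‖ ≤ ((n : ℝ) + 1) ^ 2 * R ^ n * (2 * ‖b 0‖ + 2 * ‖b 1‖ / R + ‖b 2‖ / R ^ 2) := by
  obtain ⟨τ₁, hτ₁⟩ := exists_cubic_root A B C
  have hnτ : ‖τ₁‖ ≤ R := hroot τ₁ hτ₁
  -- the cofactor `τ² + pτ + κ`
  set p : ℂ := τ₁ - A with hpdef
  set κ : ℂ := τ₁ ^ 2 - A * τ₁ - B with hκdef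
  have hC : C = τ₁ * κ := by rw [hκdef]; linear_combination (-1 : ℂ) * hτ₁
  have hfac : ∀ τ : ℂ, τ ^ 3 - A * τ ^ 2 - B * τ - C = (τ - τ₁) * (τ ^ 2 + p * τ + κ) := by
    intro τ; rw [hC, hpdef, hκdef]; ring
  have hcof : ∀ σ : ℂ, σ ^ 2 + p * σ + κ = 0 → ‖σ‖ ≤ R := by
    intro σ hσ
    exact hroot σ (by rw [hfac, hσ, mul_zero])
  -- `g(n) = b(n+1) − τ₁ b(n)` obeys the cofactor recurrence
  set g : ℕ → ℂ := fun n => b (n + 1) - τ₁ * b n with hg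
  have hgrec : ∀ n, g (n + 2) = -p * g (n + 1) - κ * g n := by
    intro n
    simp only [hg]
    rw [show n + 2 + 1 = n + 3 by omega, show n + 1 + 1 = n + 2 by omega, hb n, hC, hpdef]
    have hBk : B = p * τ₁ - κ := by rw [hκdef, hpdef]; ring
    rw [hBk, hpdef]
    ring
  set Γ : ℝ := ‖g 0‖ + ‖g 1‖ / R with hΓ
  have hΓ0 : 0 ≤ Γ := by positivity
  have hgb : ∀ m, ‖g m‖ ≤ ((m : ℝ) + 1) * R ^ m * Γ := by
    intro m
    cases m with
    | zero =>
      simp only [Nat.cast_zero, zero_add, pow_zero, one_mul, mul_one, hΓ]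
      have : 0 ≤ ‖g 1‖ / R := by positivity
      linarith
    | succ n =>
      have h := norm_le_of_rec_two_complex hR.le hcof hgrec n
      have e : R ^ (n + 1) * ‖g 0‖ + ((n : ℝ) + 1) * R ^ n * (‖g 1‖ + R * ‖g 0‖)
          = R ^ (n + 1) * (‖g 0‖ + ((n : ℝ) + 1) * (‖g 1‖ / R + ‖g 0‖)) := by
        rw [pow_succ]; field_simp
      rw [e] at h
      refine h.trans ?_
      push_cast
      rw [hΓ]
      have h1 : ‖g 0‖ + ((n : ℝ) + 1) * (‖g 1‖ / R + ‖g 0‖) ≤ ((n : ℝ) + 1 + 1) * (‖g 0‖ + ‖g 1‖ / R) := by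
        have : 0 ≤ ‖g 1‖ / R := by positivity
        nlinarith [norm_nonneg (g 0), this]
      calc R ^ (n + 1) * (‖g 0‖ + ((n : ℝ) + 1) * (‖g 1‖ / R + ‖g 0‖))
          ≤ R ^ (n + 1) * (((n : ℝ) + 1 + 1) * (‖g 0‖ + ‖g 1‖ / R)) := mul_le_mul_of_nonneg_left h1 (by positivity)
        _ = ((n : ℝ) + 1 + 1) * R ^ (n + 1) * (‖g 0‖ + ‖g 1‖ / R) := by ring
  -- discrete Duhamel: `‖b n‖ ≤ Rⁿ (‖b₀‖ + Γ/R · n(n+1)/2)`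
  have hduh : ∀ n, ‖b n‖ ≤ R ^ n * (‖b 0‖ + Γ / R * ((n : ℝ) * ((n : ℝ) + 1) / 2)) := by
    intro n
    induction n with
    | zero => simp
    | succ n ih =>
      have hstep : b (n + 1) = τ₁ * b n + g n := by simp only [hg]; ring
      rw [hstep]
      refine (norm_add_le _ _).trans ?_
      rw [norm_mul]
      have h1 : ‖τ₁‖ * ‖b n‖ ≤ R * (R ^ n * (‖b 0‖ + Γ / R * ((n : ℝ) * ((n : ℝ) + 1) / 2))) :=
        mul_le_mul hnτ ih (norm_nonneg _) hR.le
      have h2 := hgb n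
      push_cast
      have e : R * (R ^ n * (‖b 0‖ + Γ / R * ((n : ℝ) * ((n : ℝ) + 1) / 2))) + ((n : ℝ) + 1) * R ^ n * Γ
          = R ^ (n + 1) * (‖b 0‖ + Γ / R * (((n : ℝ) + 1) * ((n : ℝ) + 1 + 1) / 2)) := by
        rw [pow_succ]; field_simp; ring
      linarith [h1, h2, e.le, e.ge]
  -- the stated form
  have hg0 : ‖g 0‖ ≤ ‖b 1‖ + R * ‖b 0‖ := by
    simp only [hg]
    refine (norm_sub_le _ _).trans ?_
    rw [norm_mul]
    have := mul_le_mul_of_nonneg_right hnτ (norm_nonneg (b 0))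
    linarith
  have hg1 : ‖g 1‖ ≤ ‖b 2‖ + R * ‖b 1‖ := by
    simp only [hg]
    refine (norm_sub_le _ _).trans ?_
    rw [norm_mul]
    have := mul_le_mul_of_nonneg_right hnτ (norm_nonneg (b 1))
    linarith
  have hΓb : Γ / R ≤ ‖b 0‖ + 2 * ‖b 1‖ / R + ‖b 2‖ / R ^ 2 := by
    rw [hΓ, div_le_iff₀ hR]
    have e : (‖b 0‖ + 2 * ‖b 1‖ / R + ‖b 2‖ / R ^ 2) * R = R * ‖b 0‖ + 2 * ‖b 1‖ + ‖b 2‖ / R := by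
      field_simp
    rw [e]
    have h1 : ‖g 1‖ / R ≤ ‖b 2‖ / R + ‖b 1‖ := by
      rw [div_le_iff₀ hR, add_mul, div_mul_cancel₀ _ hR.ne']
      linarith [hg1]
    linarith [hg0, h1]
  have hquad : (n : ℝ) * ((n : ℝ) + 1) / 2 ≤ ((n : ℝ) + 1) ^ 2 := by nlinarith [Nat.cast_nonneg (α := ℝ) n]
  calc ‖b n‖ ≤ R ^ n * (‖b 0‖ + Γ / R * ((n : ℝ) * ((n : ℝ) + 1) / 2)) := hduh n
    _ ≤ R ^ n * (((n : ℝ) + 1) ^ 2 * ‖b 0‖ + (‖b 0‖ + 2 * ‖b 1‖ / R + ‖b 2‖ / R ^ 2) * ((n : ℝ) + 1) ^ 2) := by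
        refine mul_le_mul_of_nonneg_left ?_ (by positivity)
        have h1 : ‖b 0‖ ≤ ((n : ℝ) + 1) ^ 2 * ‖b 0‖ := by
          have : (1 : ℝ) ≤ ((n : ℝ) + 1) ^ 2 := by nlinarith [Nat.cast_nonneg (α := ℝ) n]
          nlinarith [norm_nonneg (b 0)]
        have h2 : Γ / R * ((n : ℝ) * ((n : ℝ) + 1) / 2) ≤ (‖b 0‖ + 2 * ‖b 1‖ / R + ‖b 2‖ / R ^ 2) * ((n : ℝ) + 1) ^ 2 :=
          mul_le_mul hΓb hquad (by positivity) (by positivity)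
        linarith
    _ = ((n : ℝ) + 1) ^ 2 * R ^ n * (2 * ‖b 0‖ + 2 * ‖b 1‖ / R + ‖b 2‖ / R ^ 2) := by ring

end Literature.Analysis.Asymptotics

end
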